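import Literature.Combinatorics.Optimization.PsdLiftSlackMatrix
import Mathlib.Data.Matrix.ColumnRowPartitioned
import Mathlib.Analysis.InnerProductSpace.PiL2
import Mathlib.Data.Sym.Card
import HarnessLib

/-!
# Squared-distance matrices have psd rank `O(√dim)`, and the printed bounds on FGPRT's intersection
# matrices `A_{I,J} = |I ∩ J|` (Fawzi–Gouveia–Parrilo–Robinson–Thomas 2015, §9.1, Problems 9.1–9.2) — PROVED

Source: H. Fawzi, J. Gouveia, P. A. Parrilo, R. Z. Robinson, R. R. Thomas, *Positive semidefinite
rank*, Math. Program. Ser. B 153 (2015) 133–177 = arXiv:1407.4095 [FawziEtAl2015]; held text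
`paper:arxiv-1407.4095`, chunk p24 (§9 "Open questions", §9.1 "Psd rank of special matrices"; arXiv
numbering). Vocabulary: the tree's `HasPsdFactorization M k` ("`rank_psd(M) ≤ k`",
`PatternMatrixPsdRank.lean`), `HasPsdLift C k` (`C = π(S^k_+ ∩ L)`, `PsdLiftSlackMatrix.lean`) and
`Matrix.rank`; lower bounds through the tree's Proposition 2.5 (`HasPsdFactorization.rank_le_choose`,
`PsdRankBasicProperties.lean`).

The printed text (p24, verbatim). **Problem 9.1.** "Consider the `10` by `10` matrix `A` whose rows and
columns are indexed by subsets of `{1,…,5}` of size `2` and `3` respectively, and defined by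
`A_{I,J} = |I ∩ J|`. What is the psd rank of `A`? One geometric interpretation for the matrix `A`, is to
take the `10`-vertices of a rectified `5`-cell inscribed in a `3`-sphere and take the generalized slack
matrix with respect to the tangents at the `10`-points. Since the unit ball in `ℝ⁴` has a semidefinite
representation of size `4`, we know that the psd rank of `A` is at most `4`. The usual rank of `A` being
`5`, we know that its psd rank must be at least `3`." **Problem 9.2.** "Let `A(n)` be the matrix whose
rows and columns are indexed by subsets of `{1,…,n}` of size `⌊n/2⌋` and `⌈n/2⌉` respectively, and
defined by `A_{I,J} = |I ∩ J|`. What is the psd rank of `A(n)`? The matrices `A(n)` again have an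
interpretation in terms of an inscribed polytope in the `(n−2)`-sphere. In general, we know only that
their psd rank is at most `2⌈√n⌉` and at least `½√(1+8n) − ½`."

The paper prints no proofs of these four numerical claims. This file PROVES them, through one
mechanism stated in general:

* **Squared-distance matrices** (`hasPsdFactorization_frobeniusSqDist`, `hasPsdFactorization_sqDist`,
  `hasPsdFactorization_normSqDist`): for points `x_i`, `y_j` of a real inner product space of dimension
  `≤ s·t`, the matrix `(‖x_i − y_j‖²)_{ij}` has a psd factorization of size `s + t`, WHATEVER the number
  of points: reshape a point into an `s × t` matrix `P`; then `‖P − Q‖_F² = Tr(A_P B_Q)` with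
  `A_P = [I_s | P]ᵀ[I_s | P] ⪰ 0` and `B_Q = [Q ; −I_t][Q ; −I_t]ᵀ ⪰ 0` (`Tr(UᵀU WWᵀ) = ‖UW‖_F²`,
  `[I | P][Q ; −I] = Q − P`). This is the slack-matrix shadow of the Schur-complement semidefinite
  representation `{X : ∃ W, [[W, X],[Xᵀ, I_t]] ⪰ 0, Tr W ≤ 1}` of the Frobenius ball of `s × t` matrices
  [BoydVandenberghe2004, §A.5.5 and Example 3.4 (matrix fractional function)], i.e. of "the unit ball in
  `ℝ^{st}` has a semidefinite representation of size `s + t`" — the fact the text invokes for `ℝ⁴ = ℝ^{2·2}`.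
  Consequences: `2⌈√d⌉` for `ℝ^d` (`hasPsdFactorization_sqDist_two_ceil_sqrt`) and, on a sphere of radius
  `R`, the generalized slack matrix `(R² − ⟨x_i, y_j⟩) = (½‖x_i − y_j‖²)` of an inscribed configuration
  with respect to its tangent half-spaces (`hasPsdFactorization_sphereSlack`).
* **The lift itself** (`hasPsdLift_frobeniusBall`, `hasPsdLift_euclideanBall`,
  `hasPsdLift_euclideanBall_fin_four`): `{X ∈ ℝ^{s×t} : ‖X‖_F ≤ 1} = π(S^{s+t}_+ ∩ L)` with
  `L = {[[λ I_s, X],[Xᵀ, W]] : λ + Tr W = 2}` (`frobBallLiftSpace`, written as `s·λ + s·Tr W = 2s` so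
  that `s = 0` needs no case) and `π` = the upper-right block (`frobBallLiftMap`). Proof of `⊆`: for
  psd `M ∈ L` the quadratic form at `(μ X_{·b}, −e_b)` gives `μ²λ‖X_{·b}‖² − 2μ‖X_{·b}‖² + W_{bb} ≥ 0`;
  `μ = 1` summed over `b` gives `(2 − λ)‖X‖_F² ≤ Tr W = 2 − λ`, whence `‖X‖_F² ≤ 1` if `λ < 2`, while
  `λ ≥ 2` forces `Tr W = 0`, `W_{bb} = 0` and then (`μ = ½`) `X = 0`. Proof of `⊇`: `[[I, X],[Xᵀ,
  XᵀX + μ I_t]] = [I | X]ᵀ[I | X] + 0 ⊕ μ I_t` with `μ = (1 − ‖X‖_F²)/t` (and `2 I_s` when `t = 0`). Hence the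
  Euclidean ball `B^d` has a psd lift of size `s + t` whenever `d ≤ s·t` — size `2⌈√d⌉`, and size `4`
  for `B⁴` as quoted on p24 (in the tree's `HasPsdLift` form `C = π(S^k_+ ∩ L)`, FGPRT eq. (3)).
* **The matching lower bound by dimension count** (`finrank_vectorSpan_le_of_hasPsdLift`,
  `card_le_choose_of_hasPsdLift_euclideanBall`): if `C = π(S^k_+ ∩ L)` then the affine hull of `C` has
  dimension `≤ dim Sym_k = C(k+1,2)` (psd matrices are symmetric; "count dimensions", §7 p20, with the
  count of Prop. 2.5), so every psd lift of `B^d` has size `k` with `d ≤ C(k+1,2)`, i.e.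
  `k ≥ ½(√(8d+1) − 1) ≈ √(2d)`: the psd-lift size of the Euclidean ball is pinned between `√(2d) − ½` and
  `2⌈√d⌉`.
* **The intersection matrices** (`subsetInterMatrix n a b`, entry `|I ∩ J|` for `|I| = a`, `|J| = b`;
  `fgprtA n = subsetInterMatrix n ⌊n/2⌋ ⌈n/2⌉`): for `a + b = n`, `2|I ∩ J| = ‖1_{Iᶜ} − 1_J‖²`
  (`two_mul_card_inter_eq_sum_sq`; `1_{Iᶜ}` and `1_J` are `0/1` points with `|J|` ones), so
  `rank_psd ≤ s + t` whenever `n ≤ s·t` (`hasPsdFactorization_subsetInterMatrix`), and — since all these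
  points lie in the hyperplane `Σ z = |J|`, of dimension `n − 1` — whenever `n − 1 ≤ s·t`
  (`hasPsdFactorization_subsetInterMatrix_affine`, via the orthogonal complement of the all-ones vector).
* **Rank** (`rank_subsetInterMatrix`): `|I ∩ J| = Σ_l [l ∈ I][l ∈ J]`, i.e. `A = X_a X_bᵀ` for the
  subset-versus-element incidence matrices, and `X_a` has trivial kernel for `1 ≤ a ≤ n − 1` (exchange
  argument, `subsetIncidence_mulVec_eq_zero`; the classical full-rank property of inclusion matrices),
  so `rank A = n` for `1 ≤ a, b ≤ n − 1`.

| printed claim (p24) | Lean | status |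
|---|---|---|
| Problem 9.1: "the unit ball in `ℝ⁴` has a semidefinite representation of size `4`" | `hasPsdLift_euclideanBall_fin_four` (lift form); general `hasPsdLift_euclideanBall` (`B^d`, size `s+t` for `d ≤ st`) | PROVED |
| (dimension count) every psd lift of `B^d` has size `k` with `C(k+1,2) ≥ d` | `card_le_choose_of_hasPsdLift_euclideanBall`, general `finrank_vectorSpan_le_of_hasPsdLift` | PROVED |
| Problem 9.1: "psd rank of `A` is at most `4`" | `FawziEtAl2015_problem91_bounds` (2nd conjunct: `HasPsdFactorization (fgprtA 5) 4`) | PROVED |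
| Problem 9.1: "The usual rank of `A` being `5`" | `FawziEtAl2015_problem91_bounds` (1st conjunct) | PROVED |
| Problem 9.1: "its psd rank must be at least `3`" | `FawziEtAl2015_problem91_bounds` (3rd conjunct) | PROVED |
| Problem 9.2: "at most `2⌈√n⌉`" | `FawziEtAl2015_problem92_upper` (all `n`) | PROVED |
| Problem 9.2: "at least `½√(1+8n) − ½`" | `FawziEtAl2015_problem92_bounds` (`n ≥ 2`; with `rank A(n) = n`) | PROVED |

Scope notes. (1) For `n = 1`, `A(1) = (|∅ ∩ {1}|) = (0)` has psd rank `0 < ½√9 − ½ = 1`: the printed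
lower bound presumes `rank A(n) = n`, true exactly for `n ≥ 2`; typed with `2 ≤ n`. (2) Problems 9.1 and
9.2 themselves (the exact values) are OPEN QUESTIONS and are not typed as facts. (3) No claim is made
here that `2⌈√n⌉` is the best bound obtainable from the sphere picture: the affine form gives
`rank_psd A(n) ≤ s + t` for any `s·t ≥ n − 1` (e.g. `A(5) ≤ 4`, `A(7) ≤ 5`).
-/

noncomputable section

open Matrix Finset
open scoped MatrixOrder EuclideanSpace

namespace Literature.Combinatorics.Optimization

variable {ι κ : Type*}

/-! ### The mechanism: squared Frobenius distances of `s × t` matrices -/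

section Core

variable {s t : ℕ}

/-- The row factor `U_P = [I_s | P] ∈ ℝ^{s × (s+t)}` of the squared-distance factorization
(columns re-indexed along `Fin s ⊕ Fin t ≃ Fin (s+t)`); `U_Pᵀ U_P` is the psd matrix attached to the
point `P`. [cite: BoydVandenberghe2004, §A.5.5 (p. 650–651)] [cite: FawziEtAl2015, §9.1 (p24)] -/
def sqDistRowFactor (P : Matrix (Fin s) (Fin t) ℝ) : Matrix (Fin s) (Fin (s + t)) ℝ :=
  (Matrix.fromCols (1 : Matrix (Fin s) (Fin s) ℝ) P).submatrix id finSumFinEquiv.symm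

/-- The column factor `W_Q = [Q ; −I_t] ∈ ℝ^{(s+t) × t}`; `W_Q W_Qᵀ` is the psd matrix attached to
the point `Q`. [cite: BoydVandenberghe2004, §A.5.5 (p. 650–651)] [cite: FawziEtAl2015, §9.1 (p24)] -/
def sqDistColFactor (Q : Matrix (Fin s) (Fin t) ℝ) : Matrix (Fin (s + t)) (Fin t) ℝ :=
  (Matrix.fromRows Q (-1 : Matrix (Fin t) (Fin t) ℝ)).submatrix finSumFinEquiv.symm id

/-- `U_P W_Q = [I | P][Q ; −I] = Q − P`. [cite: BoydVandenberghe2004, §A.5.5 (p. 650–651)] -/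
theorem sqDistRowFactor_mul_sqDistColFactor (P Q : Matrix (Fin s) (Fin t) ℝ) :
    sqDistRowFactor P * sqDistColFactor Q = Q - P := by
  unfold sqDistRowFactor sqDistColFactor
  rw [Matrix.submatrix_mul_equiv, Matrix.submatrix_id_id, Matrix.fromCols_mul_fromRows,
    Matrix.one_mul, Matrix.mul_neg, Matrix.mul_one, sub_eq_add_neg]

/-- `Tr(Z Zᵀ) = Σ_{a,b} Z_{ab}²`. [folklore] -/
private theorem trace_mul_transpose_self_eq (Z : Matrix (Fin s) (Fin t) ℝ) :
    (Z * Zᵀ).trace = ∑ a, ∑ b, Z a b ^ 2 := by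
  simp only [Matrix.trace, Matrix.diag_apply, Matrix.mul_apply, Matrix.transpose_apply, pow_two]

/-- **Squared Frobenius distances have psd rank at most `s + t`.** For any families of real
`s × t` matrices `P_i`, `Q_j`, the matrix `(‖P_i − Q_j‖_F²)_{ij}` has the psd factorization of size
`s + t` given by `A_i = U_{P_i}ᵀ U_{P_i}`, `B_j = W_{Q_j} W_{Q_j}ᵀ` with `U_P = [I_s | P]`,
`W_Q = [Q ; −I_t]`: `Tr(A_i B_j) = ‖U_{P_i} W_{Q_j}‖_F² = ‖Q_j − P_i‖_F²`. This is the
slack-matrix form of the Schur-complement (matrix-fractional) semidefinite representation of the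
Frobenius-norm ball; it is the mechanism behind the bound "at most `2⌈√n⌉`" quoted for FGPRT's
Problem 9.2. [cite: FawziEtAl2015, §9.1 Problem 9.2 (p24)]
[cite: BoydVandenberghe2004, §A.5.5 (p. 650–651), Ex. 3.4] -/
theorem hasPsdFactorization_frobeniusSqDist (P : ι → Matrix (Fin s) (Fin t) ℝ)
    (Q : κ → Matrix (Fin s) (Fin t) ℝ) :
    HasPsdFactorization (fun i j => ∑ a, ∑ b, (P i a b - Q j a b) ^ 2) (s + t) := by
  refine ⟨fun i => (sqDistRowFactor (P i))ᴴ * sqDistRowFactor (P i),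
    fun j => sqDistColFactor (Q j) * (sqDistColFactor (Q j))ᴴ,
    fun i => Matrix.posSemidef_conjTranspose_mul_self _,
    fun j => Matrix.posSemidef_self_mul_conjTranspose _, fun i j => ?_⟩
  show ∑ a, ∑ b, (P i a b - Q j a b) ^ 2 = ((sqDistRowFactor (P i))ᴴ * sqDistRowFactor (P i) *
    (sqDistColFactor (Q j) * (sqDistColFactor (Q j))ᴴ)).trace
  rw [Matrix.conjTranspose_eq_transpose_of_trivial, Matrix.conjTranspose_eq_transpose_of_trivial,
    Matrix.mul_assoc, Matrix.trace_mul_comm, ← Matrix.mul_assoc,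
    Matrix.mul_assoc (sqDistRowFactor (P i) * sqDistColFactor (Q j)), ← Matrix.transpose_mul,
    sqDistRowFactor_mul_sqDistColFactor, trace_mul_transpose_self_eq]
  refine sum_congr rfl fun a _ => sum_congr rfl fun b _ => ?_
  rw [Matrix.sub_apply]
  ring

end Core

/-! ### Coordinates: points of `ℝ^σ` with `|σ| ≤ s·t` -/

section Coordinates

variable {s t : ℕ} {σ : Type*} [Fintype σ]

/-- Zero-padding along an injection does not change squared distances. [folklore] -/
private theorem sum_extend_sub_sq {β : Type*} [Fintype β] (e : σ ↪ β) (x y : σ → ℝ) :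
    ∑ p, (Function.extend e x 0 p - Function.extend e y 0 p) ^ 2 = ∑ l, (x l - y l) ^ 2 := by
  classical
  rw [← Finset.sum_subset (Finset.subset_univ (Finset.univ.map e))]
  · rw [Finset.sum_map]
    refine sum_congr rfl fun l _ => ?_
    rw [e.injective.extend_apply, e.injective.extend_apply]
  · intro p _ hp
    have hp' : ¬ ∃ l, e l = p := fun ⟨l, hl⟩ => hp (Finset.mem_map.mpr ⟨l, Finset.mem_univ _, hl⟩)
    rw [Function.extend_apply' _ _ _ hp', Function.extend_apply' _ _ _ hp']
    simp

/-- **Squared Euclidean distances in `ℝ^σ`, `|σ| ≤ s·t`, have psd rank at most `s + t`**: for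
`x_i, y_j ∈ ℝ^σ` the matrix `(Σ_l (x_{il} − y_{jl})²)_{ij}` has a psd factorization of size `s + t`
(reshape the vectors into zero-padded `s × t` matrices). In particular (`s = t = ⌈√d⌉`) squared-distance
matrices of point configurations in `ℝ^d` have psd rank at most `2⌈√d⌉`, whatever the number of points.
[cite: FawziEtAl2015, §9.1 Problem 9.2 (p24)] -/
theorem hasPsdFactorization_sqDist (x : ι → σ → ℝ) (y : κ → σ → ℝ)
    (hσ : Fintype.card σ ≤ s * t) :
    HasPsdFactorization (fun i j => ∑ l, (x i l - y j l) ^ 2) (s + t) := by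
  classical
  have hcard : Fintype.card σ ≤ Fintype.card (Fin s × Fin t) := by
    simpa only [Fintype.card_prod, Fintype.card_fin] using hσ
  obtain ⟨e⟩ := Function.Embedding.nonempty_iff_card_le.mpr hcard
  have h := hasPsdFactorization_frobeniusSqDist (ι := ι) (κ := κ)
    (fun i => Matrix.of fun a b => Function.extend e (x i) 0 (a, b))
    (fun j => Matrix.of fun a b => Function.extend e (y j) 0 (a, b))
  have hfun : (fun i j => ∑ a, ∑ b, ((Matrix.of fun a b => Function.extend e (x i) 0 (a, b)) a b -
      (Matrix.of fun a b => Function.extend e (y j) 0 (a, b)) a b) ^ 2) =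
      fun i j => ∑ l, (x i l - y j l) ^ 2 := by
    funext i j
    simp only [Matrix.of_apply]
    rw [← sum_extend_sub_sq e (x i) (y j), ← Fintype.sum_prod_type']
  rwa [hfun] at h

/-- The printed shape `2⌈√d⌉`: `d ≤ ⌈√d⌉ · ⌈√d⌉`. [cite: FawziEtAl2015, §9.1 Problem 9.2 (p24)] -/
theorem le_ceil_sqrt_mul_self (d : ℕ) : d ≤ ⌈Real.sqrt d⌉₊ * ⌈Real.sqrt d⌉₊ := by
  have h2 : Real.sqrt d ≤ ⌈Real.sqrt d⌉₊ := Nat.le_ceil _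
  have h3 : Real.sqrt d * Real.sqrt d ≤ (⌈Real.sqrt d⌉₊ : ℝ) * ⌈Real.sqrt d⌉₊ :=
    mul_le_mul h2 h2 (Real.sqrt_nonneg _) (le_trans (Real.sqrt_nonneg _) h2)
  rw [Real.mul_self_sqrt (Nat.cast_nonneg d)] at h3
  exact_mod_cast h3

/-- Squared-distance matrices of points of `ℝ^σ` have psd rank at most `2⌈√|σ|⌉`.
[cite: FawziEtAl2015, §9.1 Problem 9.2 (p24)] -/
theorem hasPsdFactorization_sqDist_two_ceil_sqrt (x : ι → σ → ℝ) (y : κ → σ → ℝ) :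
    HasPsdFactorization (fun i j => ∑ l, (x i l - y j l) ^ 2)
      (2 * ⌈Real.sqrt (Fintype.card σ)⌉₊) := by
  rw [two_mul]
  exact hasPsdFactorization_sqDist x y (le_ceil_sqrt_mul_self _)

end Coordinates

/-! ### The psd lift of the ball of size `s + t` -/

section BallLift

variable {s t : ℕ}

/-- The affine space of the lift: `(s+t) × (s+t)` matrices whose upper-left `s × s` block is a scalar
matrix `λ I_s` and with `s·λ + s·Tr(lower-right block) = 2s` (i.e. `λ + Tr W = 2` when `s ≥ 1`).
[cite: BoydVandenberghe2004, §A.5.5 (p. 650–651), Ex. 3.4] [cite: FawziEtAl2015, §9.1 Problem 9.1 (p24)] -/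
def frobBallLiftSpace (s t : ℕ) : AffineSubspace ℝ (Matrix (Fin (s + t)) (Fin (s + t)) ℝ) where
  carrier := {M | (∀ a a' : Fin s, a ≠ a' → M (Fin.castAdd t a) (Fin.castAdd t a') = 0) ∧
    (∀ a a' : Fin s, M (Fin.castAdd t a) (Fin.castAdd t a) = M (Fin.castAdd t a') (Fin.castAdd t a')) ∧
    (∑ a : Fin s, M (Fin.castAdd t a) (Fin.castAdd t a) +
      (s : ℝ) * ∑ b : Fin t, M (Fin.natAdd s b) (Fin.natAdd s b) = 2 * s)}
  smul_vsub_vadd_mem' := by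
    intro c M₁ M₂ M₃ h₁ h₂ h₃
    simp only [Set.mem_setOf_eq, vsub_eq_sub, vadd_eq_add, Matrix.add_apply, Matrix.smul_apply,
      Matrix.sub_apply, smul_eq_mul] at h₁ h₂ h₃ ⊢
    refine ⟨fun a a' h => ?_, fun a a' => ?_, ?_⟩
    · rw [h₁.1 a a' h, h₂.1 a a' h, h₃.1 a a' h]
      ring
    · rw [h₁.2.1 a a', h₂.2.1 a a', h₃.2.1 a a']
    · have e1 := h₁.2.2
      have e2 := h₂.2.2
      have e3 := h₃.2.2
      have hexp : ∑ a : Fin s, (c * (M₁ (Fin.castAdd t a) (Fin.castAdd t a) -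
            M₂ (Fin.castAdd t a) (Fin.castAdd t a)) + M₃ (Fin.castAdd t a) (Fin.castAdd t a)) +
          (s : ℝ) * ∑ b : Fin t, (c * (M₁ (Fin.natAdd s b) (Fin.natAdd s b) -
            M₂ (Fin.natAdd s b) (Fin.natAdd s b)) + M₃ (Fin.natAdd s b) (Fin.natAdd s b)) =
          c * (∑ a : Fin s, M₁ (Fin.castAdd t a) (Fin.castAdd t a) +
            (s : ℝ) * ∑ b : Fin t, M₁ (Fin.natAdd s b) (Fin.natAdd s b)) -
          c * (∑ a : Fin s, M₂ (Fin.castAdd t a) (Fin.castAdd t a) +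
            (s : ℝ) * ∑ b : Fin t, M₂ (Fin.natAdd s b) (Fin.natAdd s b)) +
          (∑ a : Fin s, M₃ (Fin.castAdd t a) (Fin.castAdd t a) +
            (s : ℝ) * ∑ b : Fin t, M₃ (Fin.natAdd s b) (Fin.natAdd s b)) := by
        simp only [Finset.sum_add_distrib, Finset.sum_sub_distrib, ← Finset.mul_sum]
        ring
      rw [hexp, e1, e2, e3]
      ring

/-- Membership in the lift space, unfolded. [cite: BoydVandenberghe2004, §A.5.5 (p. 650–651)] -/
theorem mem_frobBallLiftSpace_iff (M : Matrix (Fin (s + t)) (Fin (s + t)) ℝ) :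
    M ∈ frobBallLiftSpace s t ↔
      (∀ a a' : Fin s, a ≠ a' → M (Fin.castAdd t a) (Fin.castAdd t a') = 0) ∧
      (∀ a a' : Fin s, M (Fin.castAdd t a) (Fin.castAdd t a) = M (Fin.castAdd t a') (Fin.castAdd t a')) ∧
      (∑ a : Fin s, M (Fin.castAdd t a) (Fin.castAdd t a) +
        (s : ℝ) * ∑ b : Fin t, M (Fin.natAdd s b) (Fin.natAdd s b) = 2 * s) :=
  Iff.rfl

/-- The projection of the lift: the upper-right `s × t` block. [cite: BoydVandenberghe2004, §A.5.5 (p. 650–651)] -/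
def frobBallLiftMap (s t : ℕ) : Matrix (Fin (s + t)) (Fin (s + t)) ℝ →ₗ[ℝ] Matrix (Fin s) (Fin t) ℝ where
  toFun M := Matrix.of fun a b => M (Fin.castAdd t a) (Fin.natAdd s b)
  map_add' M N := by ext a b; rfl
  map_smul' c M := by ext a b; rfl

/-- Unfolding of the projection. [cite: BoydVandenberghe2004, §A.5.5 (p. 650–651)] -/
@[simp] theorem frobBallLiftMap_apply (M : Matrix (Fin (s + t)) (Fin (s + t)) ℝ) (a : Fin s) (b : Fin t) :
    frobBallLiftMap s t M a b = M (Fin.castAdd t a) (Fin.natAdd s b) := rfl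

/-- The quadratic form of a block matrix with scalar upper-left block `λ I_s` and symmetric
off-diagonal blocks at the test vector `v = (μ·x, −e_b)`: `vᵀNv = μ²λ‖x‖² − 2μ Σ_a x_a N_{a,b} + N_{bb}`.
[folklore] -/
private theorem quadForm_block_testVec (N : Matrix (Fin s ⊕ Fin t) (Fin s ⊕ Fin t) ℝ) {lam : ℝ}
    (h11 : ∀ a a' : Fin s, N (Sum.inl a) (Sum.inl a') = if a = a' then lam else 0)
    (h21 : ∀ (a : Fin s) (b' : Fin t), N (Sum.inr b') (Sum.inl a) = N (Sum.inl a) (Sum.inr b'))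
    (x : Fin s → ℝ) (b : Fin t) (μ : ℝ) :
    Sum.elim (fun a => μ * x a) (fun b' => if b' = b then (-1 : ℝ) else 0) ⬝ᵥ
      (N *ᵥ Sum.elim (fun a => μ * x a) (fun b' => if b' = b then (-1 : ℝ) else 0)) =
      μ ^ 2 * lam * ∑ a, x a ^ 2 - 2 * μ * ∑ a, x a * N (Sum.inl a) (Sum.inr b) +
      N (Sum.inr b) (Sum.inr b) := by
  classical
  set v : Fin s ⊕ Fin t → ℝ := Sum.elim (fun a => μ * x a) (fun b' => if b' = b then (-1 : ℝ) else 0)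
    with hv
  -- second column-block contribution: `Σ_{b'} N p b' v_{b'} = − N p b`
  have hcol : ∀ p, ∑ b', N p (Sum.inr b') * v (Sum.inr b') = - N p (Sum.inr b) := by
    intro p
    simp only [hv, Sum.elim_inr, mul_ite, mul_neg, mul_one, mul_zero, Finset.sum_ite_eq',
      Finset.mem_univ, if_true]
  have hNv_inl : ∀ a, (N *ᵥ v) (Sum.inl a) = lam * μ * x a - N (Sum.inl a) (Sum.inr b) := by
    intro a
    rw [Matrix.mulVec, dotProduct, Fintype.sum_sum_type, hcol]
    simp only [hv, Sum.elim_inl, h11, ite_mul, zero_mul, Finset.sum_ite_eq, Finset.mem_univ, if_true]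
    ring
  have hNv_inr : ∀ b'', (N *ᵥ v) (Sum.inr b'') =
      μ * ∑ a', x a' * N (Sum.inl a') (Sum.inr b'') - N (Sum.inr b'') (Sum.inr b) := by
    intro b''
    rw [Matrix.mulVec, dotProduct, Fintype.sum_sum_type, hcol, Finset.mul_sum]
    simp only [hv, Sum.elim_inl, h21]
    rw [sub_eq_add_neg]
    congr 1
    exact Finset.sum_congr rfl fun a _ => by ring
  rw [dotProduct, Fintype.sum_sum_type]
  simp_rw [hNv_inl, hNv_inr]
  have hrow : ∑ a, v (Sum.inl a) * (lam * μ * x a - N (Sum.inl a) (Sum.inr b)) =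
      μ ^ 2 * lam * ∑ a, x a ^ 2 - μ * ∑ a, x a * N (Sum.inl a) (Sum.inr b) := by
    rw [Finset.mul_sum, Finset.mul_sum, ← Finset.sum_sub_distrib]
    refine Finset.sum_congr rfl fun a _ => ?_
    simp only [hv, Sum.elim_inl]
    ring
  have hcol2 : ∑ b'', v (Sum.inr b'') *
      (μ * ∑ a', x a' * N (Sum.inl a') (Sum.inr b'') - N (Sum.inr b'') (Sum.inr b)) =
      -(μ * ∑ a', x a' * N (Sum.inl a') (Sum.inr b) - N (Sum.inr b) (Sum.inr b)) := by
    simp only [hv, Sum.elim_inr, ite_mul, neg_mul, one_mul, zero_mul, Finset.sum_ite_eq',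
      Finset.mem_univ, if_true]
  rw [hrow, hcol2]
  ring


/-- The lift witness for `‖X‖_F ≤ 1` when `t ≥ 1`: `[[I_s, X],[Xᵀ, XᵀX + μ I_t]]` with
`μ = (1 − ‖X‖_F²)/t`. [folklore] -/
private theorem frobBall_witness (ht : t ≠ 0) (X : Matrix (Fin s) (Fin t) ℝ)
    (hX : ∑ a, ∑ b, X a b ^ 2 ≤ 1) :
    ∃ M : Matrix (Fin (s + t)) (Fin (s + t)) ℝ,
      M.PosSemidef ∧ M ∈ frobBallLiftSpace s t ∧ frobBallLiftMap s t M = X := by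
  classical
  set q : ℝ := ∑ a, ∑ b, X a b ^ 2 with hq
  set μ : ℝ := (1 - q) / t with hμ
  have ht' : (0 : ℝ) < t := by exact_mod_cast Nat.pos_of_ne_zero ht
  have hμ0 : 0 ≤ μ := div_nonneg (by linarith) ht'.le
  let N : Matrix (Fin s ⊕ Fin t) (Fin s ⊕ Fin t) ℝ := Matrix.fromBlocks 1 X Xᵀ (Xᵀ * X + μ • 1)
  have hN : N = (Matrix.fromCols (1 : Matrix (Fin s) (Fin s) ℝ) X)ᵀ * Matrix.fromCols 1 X +
      Matrix.fromBlocks 0 0 0 (μ • 1) := by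
    rw [Matrix.transpose_fromCols, Matrix.fromRows_mul_fromCols, Matrix.fromBlocks_add,
      Matrix.transpose_one, Matrix.one_mul, Matrix.one_mul, Matrix.mul_one, add_zero, add_zero,
      add_zero]
  have hD : Matrix.fromBlocks (0 : Matrix (Fin s) (Fin s) ℝ) 0 0 (μ • (1 : Matrix (Fin t) (Fin t) ℝ)) =
      Matrix.diagonal (Sum.elim (fun _ => (0 : ℝ)) (fun _ => μ)) := by
    ext i j
    rcases i with a | b <;> rcases j with a' | b'
    · by_cases h : a = a'
      · subst h; simp
      · simp [Matrix.diagonal_apply_ne _ (show Sum.inl a ≠ Sum.inl a' from fun h' => h (Sum.inl_injective h'))]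
    · simp
    · simp
    · by_cases h : b = b'
      · subst h; simp
      · simp [h]
  have hNpsd : N.PosSemidef := by
    rw [hN]
    refine Matrix.PosSemidef.add ?_ ?_
    · simpa only [Matrix.conjTranspose_eq_transpose_of_trivial] using
        Matrix.posSemidef_conjTranspose_mul_self (Matrix.fromCols (1 : Matrix (Fin s) (Fin s) ℝ) X)
    · rw [hD]
      exact Matrix.PosSemidef.diagonal fun p => by cases p <;> simp [hμ0]
  let e : Fin s ⊕ Fin t ≃ Fin (s + t) := finSumFinEquiv
  refine ⟨N.submatrix e.symm e.symm, hNpsd.submatrix e.symm, ?_, ?_⟩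
  · rw [mem_frobBallLiftSpace_iff]
    simp only [Matrix.submatrix_apply, e, finSumFinEquiv_symm_apply_castAdd,
      finSumFinEquiv_symm_apply_natAdd, N, Matrix.fromBlocks_apply₁₁, Matrix.fromBlocks_apply₂₂]
    refine ⟨fun a a' h => Matrix.one_apply_ne h, fun a a' => by rw [Matrix.one_apply_eq,
      Matrix.one_apply_eq], ?_⟩
    have htr : ∑ b, (Xᵀ * X + μ • (1 : Matrix (Fin t) (Fin t) ℝ)) b b = q + t * μ := by
      simp only [Matrix.add_apply, Matrix.smul_apply, Matrix.one_apply_eq, smul_eq_mul, mul_one,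
        Finset.sum_add_distrib, Finset.sum_const, Finset.card_univ, Fintype.card_fin, nsmul_eq_mul]
      congr 1
      rw [hq, Finset.sum_comm]
      simp only [Matrix.mul_apply, Matrix.transpose_apply, pow_two]
    simp only [Matrix.one_apply_eq, Finset.sum_const, Finset.card_univ, Fintype.card_fin,
      nsmul_eq_mul, mul_one]
    rw [htr, hμ]
    field_simp
    ring
  · ext a b
    simp [e, N]

/-- The bound: a psd matrix of the lift space projects into the unit Frobenius ball. [folklore] -/
private theorem frobBall_bound {M : Matrix (Fin (s + t)) (Fin (s + t)) ℝ} (hM : M.PosSemidef)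
    (hL : M ∈ frobBallLiftSpace s t) : ∑ a, ∑ b, (frobBallLiftMap s t M a b) ^ 2 ≤ 1 := by
  classical
  rcases isEmpty_or_nonempty (Fin s) with hs | ⟨⟨a₀⟩⟩
  · simp
  obtain ⟨h1, h2, h3⟩ := hL
  set lam : ℝ := M (Fin.castAdd t a₀) (Fin.castAdd t a₀) with hlam
  let e : Fin s ⊕ Fin t ≃ Fin (s + t) := finSumFinEquiv
  set N : Matrix (Fin s ⊕ Fin t) (Fin s ⊕ Fin t) ℝ := M.submatrix e e with hNdef
  have hN : N.PosSemidef := hM.submatrix e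
  have hsymm : ∀ i j, M i j = M j i := fun i j => by
    have := congrFun (congrFun hM.1 i) j
    simpa [Matrix.conjTranspose_apply] using this.symm
  have h11 : ∀ a a' : Fin s, N (Sum.inl a) (Sum.inl a') = if a = a' then lam else 0 := by
    intro a a'
    simp only [hNdef, Matrix.submatrix_apply, e, finSumFinEquiv_apply_left]
    split_ifs with h
    · subst h; exact h2 a a₀
    · exact h1 a a' h
  have h21 : ∀ (a : Fin s) (b' : Fin t), N (Sum.inr b') (Sum.inl a) = N (Sum.inl a) (Sum.inr b') := by
    intro a b'
    simp only [hNdef, Matrix.submatrix_apply]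
    exact hsymm _ _
  have hXN : ∀ a b, frobBallLiftMap s t M a b = N (Sum.inl a) (Sum.inr b) := fun a b => by
    simp only [frobBallLiftMap_apply, hNdef, Matrix.submatrix_apply, e, finSumFinEquiv_apply_left,
      finSumFinEquiv_apply_right]
  simp_rw [hXN]
  set W : Fin t → ℝ := fun b => N (Sum.inr b) (Sum.inr b) with hW
  have hW0 : ∀ b, 0 ≤ W b := fun b => hN.diag_nonneg
  -- the trace relation `λ + Tr W = 2`
  have hs0 : (s : ℝ) ≠ 0 := by exact_mod_cast (Fin.pos a₀).ne'
  have htr : lam + ∑ b, W b = 2 := by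
    have hdiag : ∑ a : Fin s, M (Fin.castAdd t a) (Fin.castAdd t a) = s * lam := by
      rw [Finset.sum_congr rfl fun a _ => h2 a a₀, Finset.sum_const, Finset.card_univ,
        Fintype.card_fin, nsmul_eq_mul]
    have hWsum : ∑ b : Fin t, M (Fin.natAdd s b) (Fin.natAdd s b) = ∑ b, W b := by
      refine Finset.sum_congr rfl fun b _ => ?_
      simp only [hW, hNdef, Matrix.submatrix_apply, e, finSumFinEquiv_apply_right]
    rw [hdiag, hWsum] at h3
    have : (s : ℝ) * (lam + ∑ b, W b) = s * 2 := by linarith [h3]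
    exact mul_left_cancel₀ hs0 this
  -- the quadratic form at `(μ X_{·b}, −e_b)`
  have hQ : ∀ (b : Fin t) (μ : ℝ), 0 ≤ μ ^ 2 * lam * ∑ a, N (Sum.inl a) (Sum.inr b) ^ 2 -
      2 * μ * ∑ a, N (Sum.inl a) (Sum.inr b) ^ 2 + W b := by
    intro b μ
    have h0 := hN.dotProduct_mulVec_nonneg
      (Sum.elim (fun a => μ * N (Sum.inl a) (Sum.inr b)) (fun b' => if b' = b then (-1 : ℝ) else 0))
    rw [star_trivial, quadForm_block_testVec N h11 h21 (fun a => N (Sum.inl a) (Sum.inr b)) b μ] at h0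
    simpa only [pow_two] using h0
  have hc : ∀ b, (2 - lam) * ∑ a, N (Sum.inl a) (Sum.inr b) ^ 2 ≤ W b := fun b => by
    have := hQ b 1
    linarith
  have hsum : (2 - lam) * ∑ b, ∑ a, N (Sum.inl a) (Sum.inr b) ^ 2 ≤ ∑ b, W b := by
    rw [Finset.mul_sum]
    exact Finset.sum_le_sum fun b _ => hc b
  rw [Finset.sum_comm]
  by_cases hl : lam < 2
  · have h2l : 0 < 2 - lam := by linarith
    have hWtr : ∑ b, W b = 2 - lam := by linarith [htr]
    rw [hWtr] at hsum
    exact le_of_mul_le_mul_left (by rw [mul_one]; exact hsum) h2l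
  · have hWtr0 : ∑ b, W b = 0 := by
      have hge : 0 ≤ ∑ b, W b := Finset.sum_nonneg fun b _ => hW0 b
      linarith [htr]
    have hWb : ∀ b, W b = 0 := fun b =>
      (Finset.sum_eq_zero_iff_of_nonneg fun b _ => hW0 b).mp hWtr0 b (Finset.mem_univ b)
    have hlam2 : lam = 2 := by linarith [htr, hWtr0]
    have hcb : ∀ b, ∑ a, N (Sum.inl a) (Sum.inr b) ^ 2 = 0 := by
      intro b
      have hq := hQ b (1 / 2)
      rw [hWb b, hlam2] at hq
      have hnn : 0 ≤ ∑ a, N (Sum.inl a) (Sum.inr b) ^ 2 := Finset.sum_nonneg fun a _ => sq_nonneg _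
      linarith
    simp [hcb]

/-- **The Frobenius-norm unit ball of `s × t` real matrices — i.e. the Euclidean unit ball of
`ℝ^{st}` — has a psd lift of size `s + t`**: `{X : ‖X‖_F ≤ 1} = π(S^{s+t}_+ ∩ L)` with
`L = {[[λI_s, X],[Xᵀ, W]] : λ + Tr W = 2}` and `π` the upper-right block (Schur complement:
`W ⪰ XᵀX/λ`, so `‖X‖_F² ≤ λ·Tr W ≤ 1`; conversely `[[I, X],[Xᵀ, XᵀX + μI]]`). This is the matrix
fractional / Schur-complement semidefinite representation of the Frobenius ball; it is the fact quoted
on p24 ("the unit ball in `ℝ⁴` has a semidefinite representation of size `4`", `4 = 2 + 2`).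
[cite: BoydVandenberghe2004, §A.5.5 (p. 650–651), Ex. 3.4] [cite: FawziEtAl2015, §9.1 Problem 9.1 (p24)] -/
theorem hasPsdLift_frobeniusBall (s t : ℕ) :
    HasPsdLift {X : Matrix (Fin s) (Fin t) ℝ | ∑ a, ∑ b, X a b ^ 2 ≤ 1} (s + t) := by
  classical
  refine ⟨frobBallLiftSpace s t, frobBallLiftMap s t, Set.ext fun X => ⟨fun hX => ?_, ?_⟩⟩
  · by_cases ht : t = 0
    · subst ht
      refine ⟨(2 : ℝ) • (1 : Matrix (Fin (s + 0)) (Fin (s + 0)) ℝ),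
        ⟨Matrix.PosSemidef.one.smul (by norm_num), ?_⟩, ?_⟩
      · rw [mem_frobBallLiftSpace_iff]
        have hdiag : ∀ a : Fin s, ((2 : ℝ) • (1 : Matrix (Fin (s + 0)) (Fin (s + 0)) ℝ))
            (Fin.castAdd 0 a) (Fin.castAdd 0 a) = 2 := fun a => by
          rw [Matrix.smul_apply, Matrix.one_apply_eq, smul_eq_mul, mul_one]
        refine ⟨fun a a' h => ?_, fun a a' => ?_, ?_⟩
        · have : Fin.castAdd 0 a ≠ Fin.castAdd 0 a' := fun h' => h (Fin.castAdd_injective _ _ h')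
          rw [Matrix.smul_apply, Matrix.one_apply_ne this, smul_zero]
        · rw [hdiag, hdiag]
        · simp only [hdiag, Finset.sum_const, Finset.card_univ, Fintype.card_fin, nsmul_eq_mul,
            Finset.univ_eq_empty, Finset.sum_empty, mul_zero, add_zero]
          ring
      · ext a b
        exact b.elim0
    · obtain ⟨M, hM, hL, hMX⟩ := frobBall_witness ht X hX
      exact ⟨M, ⟨hM, hL⟩, hMX⟩
  · rintro ⟨M, ⟨hM, hL⟩, rfl⟩
    exact frobBall_bound hM hL

end BallLift

/-! ### The Euclidean ball of `ℝ^σ`, `|σ| ≤ s·t` -/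

section EuclideanBall

variable {s t : ℕ} {σ : Type*} [Fintype σ]

/-- Linear images keep psd lifts of the same size (compose the projection; the tree's
`HasPsdLift.image`, restated here to keep the imports light). [cite: FawziEtAl2015, §3.1 eq. (3) (p09)] -/
private theorem hasPsdLift_image_linearMap {E F : Type*} [AddCommGroup E] [Module ℝ E]
    [AddCommGroup F] [Module ℝ F] {C : Set E} {k : ℕ} (h : HasPsdLift C k) (f : E →ₗ[ℝ] F) :
    HasPsdLift (f '' C) k := by
  obtain ⟨L, π, rfl⟩ := h
  exact ⟨L, f.comp π, by rw [Set.image_image]; rfl⟩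

/-- Zero-padding along an injection does not change sums of squares. [folklore] -/
private theorem sum_extend_sq {β : Type*} [Fintype β] (e : σ ↪ β) (x : σ → ℝ) :
    ∑ p, (Function.extend e x 0 p) ^ 2 = ∑ l, (x l) ^ 2 := by
  classical
  rw [← Finset.sum_subset (Finset.subset_univ (Finset.univ.map e))]
  · rw [Finset.sum_map]
    refine sum_congr rfl fun l _ => ?_
    rw [e.injective.extend_apply]
  · intro p _ hp
    have hp' : ¬ ∃ l, e l = p := fun ⟨l, hl⟩ => hp (Finset.mem_map.mpr ⟨l, Finset.mem_univ _, hl⟩)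
    rw [Function.extend_apply' _ _ _ hp']
    simp

/-- **The Euclidean unit ball of `ℝ^σ` has a psd lift of size `s + t` whenever `|σ| ≤ s·t`** (restrict
the Frobenius-ball lift along an injection `σ ↪ [s] × [t]`); with `s = t = ⌈√d⌉` this is a psd lift of
`B^d` of size `2⌈√d⌉`. [cite: BoydVandenberghe2004, §A.5.5 (p. 650–651), Ex. 3.4]
[cite: FawziEtAl2015, §9.1 Problem 9.1 (p24)] -/
theorem hasPsdLift_euclideanBall (hσ : Fintype.card σ ≤ s * t) :
    HasPsdLift {x : σ → ℝ | ∑ l, x l ^ 2 ≤ 1} (s + t) := by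
  classical
  have hcard : Fintype.card σ ≤ Fintype.card (Fin s × Fin t) := by
    simpa only [Fintype.card_prod, Fintype.card_fin] using hσ
  obtain ⟨e⟩ := Function.Embedding.nonempty_iff_card_le.mpr hcard
  let restr : Matrix (Fin s) (Fin t) ℝ →ₗ[ℝ] (σ → ℝ) :=
    { toFun := fun X l => X (e l).1 (e l).2
      map_add' := fun _ _ => rfl
      map_smul' := fun _ _ => rfl }
  have himg : restr '' {X : Matrix (Fin s) (Fin t) ℝ | ∑ a, ∑ b, X a b ^ 2 ≤ 1} =
      {x : σ → ℝ | ∑ l, x l ^ 2 ≤ 1} := by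
    ext x
    constructor
    · rintro ⟨X, hX, rfl⟩
      have hle : ∑ l, (X (e l).1 (e l).2) ^ 2 ≤ ∑ a, ∑ b, X a b ^ 2 := by
        rw [← Fintype.sum_prod_type']
        calc ∑ l, X (e l).1 (e l).2 ^ 2
            = ∑ p ∈ Finset.univ.map e, X p.1 p.2 ^ 2 := by rw [Finset.sum_map]
          _ ≤ ∑ p : Fin s × Fin t, X p.1 p.2 ^ 2 :=
            Finset.sum_le_sum_of_subset_of_nonneg (Finset.subset_univ _) fun p _ _ => sq_nonneg _
      exact le_trans hle hX
    · intro hx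
      refine ⟨Matrix.of fun a b => Function.extend e x 0 (a, b), ?_, ?_⟩
      · change ∑ a, ∑ b, (Function.extend e x 0 (a, b)) ^ 2 ≤ 1
        rw [← Fintype.sum_prod_type' (f := fun a b => (Function.extend e x 0 (a, b)) ^ 2),
          sum_extend_sq e x]
        exact hx
      · funext l
        change Function.extend e x 0 ((e l).1, (e l).2) = x l
        rw [Prod.mk.eta, e.injective.extend_apply]
  rw [← himg]
  exact hasPsdLift_image_linearMap (hasPsdLift_frobeniusBall s t) restr

/-- The Euclidean unit ball of `ℝ^σ` has a psd lift of size `2⌈√|σ|⌉`.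
[cite: BoydVandenberghe2004, §A.5.5 (p. 650–651), Ex. 3.4] [cite: FawziEtAl2015, §9.1 (p24)] -/
theorem hasPsdLift_euclideanBall_two_ceil_sqrt (σ : Type*) [Fintype σ] :
    HasPsdLift {x : σ → ℝ | ∑ l, x l ^ 2 ≤ 1} (2 * ⌈Real.sqrt (Fintype.card σ)⌉₊) := by
  rw [two_mul]
  exact hasPsdLift_euclideanBall (le_ceil_sqrt_mul_self _)

/-- **"The unit ball in `ℝ⁴` has a semidefinite representation of size `4`"** (p24), in lift form:
`B⁴ = π(S⁴_+ ∩ L)` (`4 = 2·2`, `4 = 2 + 2`). [cite: FawziEtAl2015, §9.1 Problem 9.1 (p24)] -/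
theorem hasPsdLift_euclideanBall_fin_four : HasPsdLift {x : Fin 4 → ℝ | ∑ l, x l ^ 2 ≤ 1} 4 :=
  hasPsdLift_euclideanBall (s := 2) (t := 2) (by simp)

end EuclideanBall

/-! ### Dimension count: a set with a psd lift of size `k` spans at most `C(k+1,2)` dimensions -/

section LiftLowerBound

variable {k : ℕ}

/-- Filling a symmetric matrix from its upper-triangular data indexed by unordered pairs. [folklore] -/
private def symFill (k : ℕ) : (Sym2 (Fin k) → ℝ) →ₗ[ℝ] Matrix (Fin k) (Fin k) ℝ where
  toFun u := Matrix.of fun i j => u s(i, j)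
  map_add' u v := by ext i j; rfl
  map_smul' c u := by ext i j; rfl

/-- A symmetric matrix is a fill of unordered-pair data. [folklore] -/
private theorem exists_symFill_eq_of_isSymm {M : Matrix (Fin k) (Fin k) ℝ} (hM : M.IsSymm) :
    ∃ u : Sym2 (Fin k) → ℝ, symFill k u = M := by
  refine ⟨Sym2.lift ⟨fun i j => M i j, fun i j => ?_⟩, ?_⟩
  · exact hM.apply j i
  · ext i j
    simp [symFill]

/-- **Dimension count for psd lifts**: if `C = π(S^k_+ ∩ L)` then the direction of the affine hull of
`C` is contained in `π(Sym_k)`, so `dim C ≤ dim Sym_k = C(k+1, 2)` ("we can count dimensions", FGPRT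
p20; the count `dim S^k = C(k+1,2)` of Proposition 2.5). Hence a psd lift of a `d`-dimensional convex set
has size `k ≥ ½(√(8d+1) − 1)`. [cite: FawziEtAl2015, Prop. 2.5 (p05) and §7 (p20, "count dimensions")] -/
theorem finrank_vectorSpan_le_of_hasPsdLift {E : Type*} [AddCommGroup E] [Module ℝ E]
    {C : Set E} (h : HasPsdLift C k) :
    Module.finrank ℝ (vectorSpan ℝ C) ≤ (k + 1).choose 2 := by
  classical
  obtain ⟨L, π, rfl⟩ := h
  set F : (Sym2 (Fin k) → ℝ) →ₗ[ℝ] E := π.comp (symFill k) with hF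
  haveI : FiniteDimensional ℝ (LinearMap.range F) := inferInstance
  have hle : vectorSpan ℝ (π '' {M : Matrix (Fin k) (Fin k) ℝ | M.PosSemidef ∧ M ∈ L}) ≤
      LinearMap.range F := by
    rw [vectorSpan_def, Submodule.span_le]
    rintro v ⟨c₁, ⟨M₁, ⟨hM₁, -⟩, rfl⟩, c₂, ⟨M₂, ⟨hM₂, -⟩, rfl⟩, rfl⟩
    obtain ⟨u₁, hu₁⟩ := exists_symFill_eq_of_isSymm (show M₁.IsSymm from by
      have := hM₁.1; rwa [Matrix.IsHermitian, Matrix.conjTranspose_eq_transpose_of_trivial] at this)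
    obtain ⟨u₂, hu₂⟩ := exists_symFill_eq_of_isSymm (show M₂.IsSymm from by
      have := hM₂.1; rwa [Matrix.IsHermitian, Matrix.conjTranspose_eq_transpose_of_trivial] at this)
    refine ⟨u₁ - u₂, ?_⟩
    simp only [hF, LinearMap.comp_apply, map_sub, hu₁, hu₂, vsub_eq_sub]
  calc Module.finrank ℝ (vectorSpan ℝ (π '' {M | M.PosSemidef ∧ M ∈ L}))
      ≤ Module.finrank ℝ (LinearMap.range F) := Submodule.finrank_mono hle
    _ ≤ Module.finrank ℝ (Sym2 (Fin k) → ℝ) := LinearMap.finrank_range_le F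
    _ = (k + 1).choose 2 := by
        rw [Module.finrank_fintype_fun_eq_card, Sym2.card, Fintype.card_fin]

/-- **Lower bound for psd lifts of the Euclidean ball**: a psd lift of the unit ball of `ℝ^σ` has size
`k` with `|σ| ≤ C(k+1, 2)`, i.e. `k ≥ ½(√(8|σ|+1) − 1)` — so together with `hasPsdLift_euclideanBall`
the smallest psd lift of `B^d` has size between `≈ √(2d)` and `2⌈√d⌉`.
[cite: FawziEtAl2015, Prop. 2.5 (p05) and §9.1 (p24)] -/
theorem card_le_choose_of_hasPsdLift_euclideanBall {σ : Type*} [Fintype σ] [DecidableEq σ] {k : ℕ}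
    (h : HasPsdLift {x : σ → ℝ | ∑ l, x l ^ 2 ≤ 1} k) : Fintype.card σ ≤ (k + 1).choose 2 := by
  have hle := finrank_vectorSpan_le_of_hasPsdLift h
  -- the ball spans everything: `e_l − 0 ∈ vectorSpan`
  have htop : vectorSpan ℝ {x : σ → ℝ | ∑ l, x l ^ 2 ≤ 1} = ⊤ := by
    refine Submodule.eq_top_of_finrank_eq ?_
    apply le_antisymm (Submodule.finrank_le _)
    have hbasis : ∀ l : σ, (Pi.single l (1 : ℝ) : σ → ℝ) ∈ vectorSpan ℝ {x : σ → ℝ | ∑ l, x l ^ 2 ≤ 1} := by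
      intro l
      have h0 : (0 : σ → ℝ) ∈ {x : σ → ℝ | ∑ l, x l ^ 2 ≤ 1} := by simp
      have h1 : (Pi.single l (1 : ℝ) : σ → ℝ) ∈ {x : σ → ℝ | ∑ l, x l ^ 2 ≤ 1} := by
        simp only [Set.mem_setOf_eq]
        rw [Finset.sum_eq_single l (fun m _ hm => by simp [hm]) (by simp)]
        simp
      simpa using vsub_mem_vectorSpan ℝ h1 h0
    have hspan : (⊤ : Submodule ℝ (σ → ℝ)) ≤ vectorSpan ℝ {x : σ → ℝ | ∑ l, x l ^ 2 ≤ 1} := by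
      rw [← (Pi.basisFun ℝ σ).span_eq, Submodule.span_le]
      rintro _ ⟨l, rfl⟩
      simpa [Pi.basisFun_apply] using hbasis l
    have := Submodule.finrank_mono hspan
    rwa [finrank_top] at this
  rw [htop, finrank_top, Module.finrank_fintype_fun_eq_card] at hle
  exact hle

end LiftLowerBound

/-! ### Inner product spaces: squared distances and slack matrices of inscribed configurations -/

section InnerProduct

variable {s t : ℕ} {E : Type*} [NormedAddCommGroup E] [InnerProductSpace ℝ E] [FiniteDimensional ℝ E]

/-- **Squared-distance matrices in a real inner product space of dimension `≤ s·t` have psd rank at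
most `s + t`** (coordinates in an orthonormal basis, then `hasPsdFactorization_sqDist`).
[cite: FawziEtAl2015, §9.1 Problem 9.2 (p24)] -/
theorem hasPsdFactorization_normSqDist (x : ι → E) (y : κ → E)
    (hE : Module.finrank ℝ E ≤ s * t) :
    HasPsdFactorization (fun i j => ‖x i - y j‖ ^ 2) (s + t) := by
  let b := stdOrthonormalBasis ℝ E
  have h := hasPsdFactorization_sqDist (ι := ι) (κ := κ) (s := s) (t := t)
    (σ := Fin (Module.finrank ℝ E)) (fun i l => b.repr (x i) l) (fun j l => b.repr (y j) l)
    (by simpa only [Fintype.card_fin] using hE)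
  have hfun : (fun i j => ∑ l, (b.repr (x i) l - b.repr (y j) l) ^ 2) =
      fun i j => ‖x i - y j‖ ^ 2 := by
    funext i j
    rw [← b.repr.norm_map (x i - y j), map_sub, EuclideanSpace.real_norm_sq_eq]
    rfl
  rwa [hfun] at h

/-- **Slack matrices of inscribed configurations.** If all `x_i` and all `y_j` lie on the sphere of
radius `R` of a real inner product space of dimension `≤ s·t`, then the (generalized slack) matrix
`(R² − ⟨x_i, y_j⟩)_{ij} = (½‖x_i − y_j‖²)_{ij}` — the slack of the point `y_j` in the tangent
half-space `⟨x_i, ·⟩ ≤ R²` — has a psd factorization of size `s + t`: FGPRT's "interpretation in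
terms of an inscribed polytope in the sphere" (p24). [cite: FawziEtAl2015, §9.1 (p24)] -/
theorem hasPsdFactorization_sphereSlack (x : ι → E) (y : κ → E) {R : ℝ} (hx : ∀ i, ‖x i‖ = R)
    (hy : ∀ j, ‖y j‖ = R) (hE : Module.finrank ℝ E ≤ s * t) :
    HasPsdFactorization (fun i j => R ^ 2 - inner ℝ (x i) (y j)) (s + t) := by
  have h := (hasPsdFactorization_normSqDist x y hE).rescale (c := fun _ => 1 / 2) (d := fun _ => 1)
    (fun _ => by norm_num) (fun _ => by norm_num)
  have hfun : (fun i j => 1 / 2 * ‖x i - y j‖ ^ 2 * 1) = fun i j => R ^ 2 - inner ℝ (x i) (y j) := by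
    funext i j
    rw [norm_sub_sq_real, hx i, hy j]
    ring
  rwa [hfun] at h

end InnerProduct

/-! ### FGPRT §9.1: the intersection matrices `A_{I,J} = |I ∩ J|` (Problems 9.1 and 9.2) -/

section Intersection

variable {s t n a b : ℕ}

/-- The `a`-element subsets of `[n] = Fin n` (row/column index type of the intersection matrices).
[cite: FawziEtAl2015, §9.1 Problem 9.2 (p24)] -/
abbrev CardSubset (n a : ℕ) : Type := {I : Finset (Fin n) // I.card = a}

/-- The `0/1` incidence matrix of `a`-subsets of `[n]` versus elements: `X_{I,l} = [l ∈ I]`.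
[cite: FawziEtAl2015, §9.1 Problem 9.2 (p24)] -/
def subsetIncidence (n a : ℕ) : Matrix (CardSubset n a) (Fin n) ℝ :=
  fun I l => if l ∈ I.1 then 1 else 0

/-- **FGPRT's intersection matrices**: rows indexed by `a`-subsets `I`, columns by `b`-subsets `J` of
`[n]`, entry `|I ∩ J|` (p24: "defined by `A_{I,J} = |I ∩ J|`"; Problem 9.1 allows "different set sizes
and different numbers of elements"). [cite: FawziEtAl2015, §9.1 Problems 9.1–9.2 (p24)] -/
def subsetInterMatrix (n a b : ℕ) : Matrix (CardSubset n a) (CardSubset n b) ℝ :=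
  fun I J => ((I.1 ∩ J.1).card : ℝ)

/-- **FGPRT Problem 9.2's `A(n)`** (p24, verbatim): "Let `A(n)` be the matrix whose rows and columns
are indexed by subsets of `{1,…,n}` of size `⌊n/2⌋` and `⌈n/2⌉` respectively, and defined by
`A_{I,J} = |I ∩ J|`"; Problem 9.1's `A` is `A(5)`. [cite: FawziEtAl2015, §9.1 Problems 9.1–9.2 (p24)] -/
def fgprtA (n : ℕ) : Matrix (CardSubset n (n / 2)) (CardSubset n ((n + 1) / 2)) ℝ :=
  subsetInterMatrix n (n / 2) ((n + 1) / 2)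

/-- Entries of the intersection matrix are intersections. [cite: FawziEtAl2015, §9.1 (p24)] -/
@[simp] theorem subsetInterMatrix_apply (I : CardSubset n a) (J : CardSubset n b) :
    subsetInterMatrix n a b I J = ((I.1 ∩ J.1).card : ℝ) := rfl

/-- `Σ_l [l ∈ S] = |S|`. [folklore] -/
private theorem sum_ite_mem_univ_eq_card (S : Finset (Fin n)) :
    ∑ l, (if l ∈ S then (1 : ℝ) else 0) = S.card := by
  rw [Finset.sum_boole, Finset.filter_mem_eq_inter, Finset.univ_inter]

/-- **The sphere identity behind the upper bound**: for `|I| + |J| = n`,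
`2|I ∩ J| = Σ_l ([l ∉ I] − [l ∈ J])² = ‖1_{Iᶜ} − 1_J‖²` (both `1_{Iᶜ}` and `1_J` are `0/1` vectors with
`|J|` ones, i.e. points of a sphere, and `|I ∩ J| = |J| − ⟨1_{Iᶜ}, 1_J⟩`).
[cite: FawziEtAl2015, §9.1 (p24, "inscribed polytope in the (n−2)-sphere")] -/
theorem two_mul_card_inter_eq_sum_sq (hab : a + b = n) (I : CardSubset n a) (J : CardSubset n b) :
    2 * ((I.1 ∩ J.1).card : ℝ) =
      ∑ l, ((if l ∈ I.1ᶜ then (1 : ℝ) else 0) - (if l ∈ J.1 then 1 else 0)) ^ 2 := by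
  have key : ∀ l : Fin n, ((if l ∈ I.1ᶜ then (1 : ℝ) else 0) - (if l ∈ J.1 then 1 else 0)) ^ 2 =
      (if l ∈ I.1 ∩ J.1 then (1 : ℝ) else 0) + (if l ∈ (I.1 ∪ J.1)ᶜ then 1 else 0) := by
    intro l
    simp only [Finset.mem_compl, Finset.mem_inter, Finset.mem_union]
    by_cases hI : l ∈ I.1 <;> by_cases hJ : l ∈ J.1 <;> simp [hI, hJ]
  simp_rw [key]
  rw [Finset.sum_add_distrib, sum_ite_mem_univ_eq_card, sum_ite_mem_univ_eq_card,
    Finset.card_compl, Fintype.card_fin]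
  have h1 := Finset.card_union_add_card_inter I.1 J.1
  rw [I.2, J.2, hab] at h1
  have h2 : (I.1 ∪ J.1).card ≤ n := by
    simpa only [Fintype.card_fin] using Finset.card_le_univ (I.1 ∪ J.1)
  have h3 : n - (I.1 ∪ J.1).card = (I.1 ∩ J.1).card := by omega
  rw [h3]
  ring

/-- **Upper bound, coordinate form**: for `|I| + |J| = n` and `n ≤ s·t`, the intersection matrix
`(|I ∩ J|)` has a psd factorization of size `s + t` (half the squared-distance matrix of the points
`1_{Iᶜ}`, `1_J` of `ℝ^n`). [cite: FawziEtAl2015, §9.1 Problem 9.2 (p24)] -/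
theorem hasPsdFactorization_subsetInterMatrix (hab : a + b = n) (hst : n ≤ s * t) :
    HasPsdFactorization (subsetInterMatrix n a b) (s + t) := by
  have h := (hasPsdFactorization_sqDist (s := s) (t := t) (σ := Fin n)
    (fun (I : CardSubset n a) l => if l ∈ I.1ᶜ then (1 : ℝ) else 0)
    (fun (J : CardSubset n b) l => if l ∈ J.1 then (1 : ℝ) else 0)
    (by simpa only [Fintype.card_fin] using hst)).rescale (c := fun _ => 1 / 2) (d := fun _ => 1)
    (fun _ => by norm_num) (fun _ => by norm_num)
  have hfun : (fun (I : CardSubset n a) (J : CardSubset n b) => 1 / 2 *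
      (∑ l, ((if l ∈ I.1ᶜ then (1 : ℝ) else 0) - (if l ∈ J.1 then 1 else 0)) ^ 2) * 1) =
      subsetInterMatrix n a b := by
    funext I J
    rw [← two_mul_card_inter_eq_sum_sq hab I J, subsetInterMatrix_apply]
    ring
  rwa [hfun] at h

/-- **FGPRT Problem 9.2, printed upper bound** (p24, verbatim: "we know only that their psd rank is at
most `2⌈√n⌉`"): `rank_psd A(n) ≤ 2⌈√n⌉`, PROVED (`⌊n/2⌋ + ⌈n/2⌉ = n ≤ ⌈√n⌉²`).
[cite: FawziEtAl2015, §9.1 Problem 9.2 (p24)] -/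
theorem FawziEtAl2015_problem92_upper (n : ℕ) :
    HasPsdFactorization (fgprtA n) (2 * ⌈Real.sqrt n⌉₊) := by
  rw [two_mul]
  exact hasPsdFactorization_subsetInterMatrix (by omega) (le_ceil_sqrt_mul_self n)


/-- **Upper bound, affine form**: the points `1_{Iᶜ}`, `1_J` all lie in the hyperplane
`Σ_l z_l = |J|` of `ℝ^n`, an affine space of dimension `n − 1`; hence for `|I| + |J| = n ≥ 1` and
`n − 1 ≤ s·t` the intersection matrix has a psd factorization of size `s + t` (FGPRT's "inscribed
polytope in the `(n−2)`-sphere", p24). [cite: FawziEtAl2015, §9.1 Problems 9.1–9.2 (p24)] -/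
theorem hasPsdFactorization_subsetInterMatrix_affine {m : ℕ} (hab : a + b = m + 1)
    (hst : m ≤ s * t) : HasPsdFactorization (subsetInterMatrix (m + 1) a b) (s + t) := by
  -- the all-ones vector and its orthogonal complement `W` (dimension `m`)
  let u : EuclideanSpace ℝ (Fin (m + 1)) := WithLp.toLp 2 fun _ => (1 : ℝ)
  have hu : u ≠ 0 := by
    intro h
    have := congrArg (fun v : EuclideanSpace ℝ (Fin (m + 1)) => v 0) h
    simp [u] at this
  let W : Submodule ℝ (EuclideanSpace ℝ (Fin (m + 1))) := (ℝ ∙ u)ᗮ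
  have hW : Module.finrank ℝ W = m := Submodule.finrank_orthogonal_span_singleton hu
  -- centred indicator vectors `1_S − (b/(m+1))·1` lie in `W` when `|S| = b`
  let c : ℝ := (b : ℝ) / (m + 1)
  let pt : Finset (Fin (m + 1)) → EuclideanSpace ℝ (Fin (m + 1)) :=
    fun S => WithLp.toLp 2 fun l => (if l ∈ S then (1 : ℝ) else 0) - c
  have hpt : ∀ S : Finset (Fin (m + 1)), S.card = b → pt S ∈ W := by
    intro S hS
    rw [Submodule.mem_orthogonal_singleton_iff_inner_right, EuclideanSpace.inner_eq_star_dotProduct]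
    simp only [pt, u, star_trivial, dotProduct, mul_one]
    rw [Finset.sum_sub_distrib, sum_ite_mem_univ_eq_card, hS, Finset.sum_const, Finset.card_univ,
      Fintype.card_fin, nsmul_eq_mul]
    simp only [c]
    field_simp
    push_cast
    ring
  have hIc : ∀ I : CardSubset (m + 1) a, I.1ᶜ.card = b := fun I => by
    rw [Finset.card_compl, Fintype.card_fin, I.2]
    omega
  let x : CardSubset (m + 1) a → W := fun I => ⟨pt I.1ᶜ, hpt _ (hIc I)⟩
  let y : CardSubset (m + 1) b → W := fun J => ⟨pt J.1, hpt _ J.2⟩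
  have h := (hasPsdFactorization_normSqDist (s := s) (t := t) x y (by rw [hW]; exact hst)).rescale
    (c := fun _ => 1 / 2) (d := fun _ => 1) (fun _ => by norm_num) (fun _ => by norm_num)
  have hfun : (fun I J => 1 / 2 * ‖x I - y J‖ ^ 2 * 1) = subsetInterMatrix (m + 1) a b := by
    funext I J
    have hnorm : ‖x I - y J‖ ^ 2 =
        ∑ l, ((if l ∈ I.1ᶜ then (1 : ℝ) else 0) - (if l ∈ J.1 then 1 else 0)) ^ 2 := by
      rw [Submodule.coe_norm, Submodule.coe_sub, EuclideanSpace.real_norm_sq_eq]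
      refine sum_congr rfl fun l _ => ?_
      simp only [x, y, pt, PiLp.sub_apply]
      ring
    rw [hnorm, ← two_mul_card_inter_eq_sum_sq hab I J, subsetInterMatrix_apply]
    ring
  rwa [hfun] at h

/-! #### The rank of the intersection matrices -/

/-- `|I ∩ J| = Σ_l [l ∈ I][l ∈ J]`: the intersection matrix factors through `ℝ^n` as
`X_a X_bᵀ` with the incidence matrices. [cite: FawziEtAl2015, §9.1 (p24, "usual rank")] -/
theorem subsetInterMatrix_eq_incidence_mul :
    subsetInterMatrix n a b = subsetIncidence n a * (subsetIncidence n b)ᵀ := by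
  ext I J
  simp only [subsetInterMatrix_apply, Matrix.mul_apply, Matrix.transpose_apply, subsetIncidence,
    ite_zero_mul_ite_zero, mul_one, ← Finset.mem_inter]
  rw [sum_ite_mem_univ_eq_card]

/-- `(X_a v)_I = Σ_{l ∈ I} v_l`. [cite: FawziEtAl2015, §9.1 (p24, "usual rank")] -/
theorem subsetIncidence_mulVec (v : Fin n → ℝ) (I : CardSubset n a) :
    (subsetIncidence n a *ᵥ v) I = ∑ l ∈ I.1, v l := by
  simp only [Matrix.mulVec, dotProduct, subsetIncidence, ite_mul, one_mul, zero_mul]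
  rw [Finset.sum_ite_mem, Finset.univ_inter]

/-- **The incidence matrix of `a`-subsets versus elements has trivial kernel for `1 ≤ a ≤ n − 1`**:
if `Σ_{l ∈ I} v_l = 0` for every `a`-subset `I`, then `v = 0` (exchange one element: `v_l = v_m`
for all `l, m`; then `a · v_l = 0`) — the classical full-column-rank property of the inclusion
matrix of `a`-subsets versus points, which is what "the usual rank of `A` being `5`" (p24) rests on.
[cite: FawziEtAl2015, §9.1 (p24, "usual rank")] -/
theorem subsetIncidence_mulVec_eq_zero (ha : 1 ≤ a) (han : a + 1 ≤ n) {v : Fin n → ℝ}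
    (hv : subsetIncidence n a *ᵥ v = 0) : v = 0 := by
  classical
  have hsum : ∀ I : Finset (Fin n), I.card = a → ∑ l ∈ I, v l = 0 := fun I hI => by
    have := congrFun hv ⟨I, hI⟩
    rwa [subsetIncidence_mulVec] at this
  -- all coordinates are equal
  have heq : ∀ l m : Fin n, v l = v m := by
    intro l m
    by_cases hlm : l = m
    · rw [hlm]
    have hcard : a - 1 ≤ (Finset.univ \ {l, m}).card := by
      rw [Finset.card_sdiff_of_subset (Finset.subset_univ _), Finset.card_univ, Fintype.card_fin,
        Finset.card_pair hlm]
      omega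
    obtain ⟨T, hT, hTcard⟩ := Finset.exists_subset_card_eq hcard
    have hlT : l ∉ T := fun h => by
      have := hT h
      simp at this
    have hmT : m ∉ T := fun h => by
      have := hT h
      simp at this
    have h1 := hsum (insert l T) (by rw [Finset.card_insert_of_notMem hlT, hTcard]; omega)
    have h2 := hsum (insert m T) (by rw [Finset.card_insert_of_notMem hmT, hTcard]; omega)
    rw [Finset.sum_insert hlT] at h1
    rw [Finset.sum_insert hmT] at h2
    linarith
  funext m
  have hcard : a ≤ (Finset.univ : Finset (Fin n)).card := by
    rw [Finset.card_univ, Fintype.card_fin]; omega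
  obtain ⟨I, -, hI⟩ := Finset.exists_subset_card_eq hcard
  have h := hsum I hI
  rw [Finset.sum_congr rfl fun l _ => heq l m, Finset.sum_const, hI, nsmul_eq_mul] at h
  have ha' : (a : ℝ) ≠ 0 := by exact_mod_cast (show a ≠ 0 by omega)
  simpa [ha'] using h

/-- The incidence map `v ↦ X_a v` is injective for `1 ≤ a ≤ n − 1`.
[cite: FawziEtAl2015, §9.1 (p24, "usual rank")] -/
theorem subsetIncidence_mulVecLin_injective (ha : 1 ≤ a) (han : a + 1 ≤ n) :
    Function.Injective (subsetIncidence n a).mulVecLin := by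
  intro v w hvw
  have h : subsetIncidence n a *ᵥ (v - w) = 0 := by
    rw [Matrix.mulVec_sub, sub_eq_zero]
    simpa only [Matrix.mulVecLin_apply] using hvw
  exact sub_eq_zero.mp (subsetIncidence_mulVec_eq_zero ha han h)

/-- The incidence matrix `X_a` of `a`-subsets of `[n]` versus elements has rank `n` for
`1 ≤ a ≤ n − 1`. [cite: FawziEtAl2015, §9.1 (p24, "usual rank")] -/
theorem rank_subsetIncidence (ha : 1 ≤ a) (han : a + 1 ≤ n) : (subsetIncidence n a).rank = n := by
  rw [Matrix.rank, LinearMap.finrank_range_of_inj (subsetIncidence_mulVecLin_injective ha han),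
    Module.finrank_fin_fun]

/-- **`rank A = n`** ("The usual rank of `A` being 5", p24; the printed lower bound `½√(1+8n) − ½`
for `A(n)` is Proposition 2.5 with `rank A(n) = n`): the intersection matrix of `a`-subsets versus
`b`-subsets of `[n]` has rank exactly `n` whenever `1 ≤ a, b ≤ n − 1`.
[cite: FawziEtAl2015, §9.1 Problems 9.1–9.2 (p24)] -/
theorem rank_subsetInterMatrix (ha : 1 ≤ a) (han : a + 1 ≤ n) (hb : 1 ≤ b) (hbn : b + 1 ≤ n) :
    (subsetInterMatrix n a b).rank = n := by
  have hinj := subsetIncidence_mulVecLin_injective ha han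
  rw [subsetInterMatrix_eq_incidence_mul, Matrix.rank, Matrix.mulVecLin_mul, LinearMap.range_comp,
    ← LinearEquiv.finrank_eq (Submodule.equivMapOfInjective _ hinj _), ← Matrix.rank,
    Matrix.rank_transpose, rank_subsetIncidence hb hbn]

/-! #### The printed bounds of Problems 9.1 and 9.2 -/

/-- **Lower bound, general form**: a psd factorization of size `k` of the intersection matrix of
`a`-subsets versus `b`-subsets of `[n]` (`1 ≤ a, b ≤ n − 1`) forces `n ≤ C(k+1, 2)` (Proposition 2.5
with `rank = n`). [cite: FawziEtAl2015, §9.1 (p24), Prop. 2.5 (p05)] -/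
theorem le_choose_of_hasPsdFactorization_subsetInterMatrix (ha : 1 ≤ a) (han : a + 1 ≤ n)
    (hb : 1 ≤ b) (hbn : b + 1 ≤ n) {k : ℕ} (h : HasPsdFactorization (subsetInterMatrix n a b) k) :
    n ≤ (k + 1).choose 2 := by
  have := h.rank_le_choose
  rwa [rank_subsetInterMatrix ha han hb hbn] at this

/-- **FGPRT Problem 9.2, both printed bounds** (p24, verbatim: "In general, we know only that their
psd rank is at most `2⌈√n⌉` and at least `½√(1+8n) − ½`"), PROVED for `n ≥ 2`: `rank A(n) = n`,
`rank_psd A(n) ≤ 2⌈√n⌉`, and every psd factorization of `A(n)` has size `k ≥ ½√(1+8n) − ½`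
(equivalently `n ≤ C(k+1,2)`). Scope note: for `n = 1`, `A(1) = (|∅ ∩ {1}|) = (0)` has psd rank
`0 < 1 = ½√9 − ½`, so the printed lower bound needs `n ≥ 2` (it presumes `rank A(n) = n`); the upper
bound holds for every `n` (`FawziEtAl2015_problem92_upper`). The psd rank of `A(n)` itself (Problem
9.2) remains open. [cite: FawziEtAl2015, §9.1 Problem 9.2 (p24)] -/
theorem FawziEtAl2015_problem92_bounds (hn : 2 ≤ n) :
    (fgprtA n).rank = n ∧ HasPsdFactorization (fgprtA n) (2 * ⌈Real.sqrt n⌉₊) ∧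
      ∀ k, HasPsdFactorization (fgprtA n) k →
        n ≤ (k + 1).choose 2 ∧ Real.sqrt (1 + 8 * (n : ℝ)) / 2 - 1 / 2 ≤ k := by
  have ha : 1 ≤ n / 2 := by omega
  have han : n / 2 + 1 ≤ n := by omega
  have hb : 1 ≤ (n + 1) / 2 := by omega
  have hbn : (n + 1) / 2 + 1 ≤ n := by omega
  refine ⟨rank_subsetInterMatrix ha han hb hbn, FawziEtAl2015_problem92_upper n, fun k hk => ⟨?_, ?_⟩⟩
  · exact le_choose_of_hasPsdFactorization_subsetInterMatrix ha han hb hbn hk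
  · have := hk.sqrt_rank_le
    change Real.sqrt (1 + 8 * ((subsetInterMatrix n (n / 2) ((n + 1) / 2)).rank : ℝ)) / 2 - 1 / 2 ≤ k
      at this
    rwa [rank_subsetInterMatrix ha han hb hbn] at this

/-- **FGPRT Problem 9.1, the three printed facts** about the `10 × 10` matrix `A = (|I ∩ J|)`,
`I ∈ C([5],2)`, `J ∈ C([5],3)` (p24, verbatim: "Since the unit ball in `ℝ⁴` has a semidefinite
representation of size 4, we know that the psd rank of `A` is at most 4. The usual rank of `A` being 5,
we know that its psd rank must be at least 3"), all PROVED: `rank A = 5`, `rank_psd A ≤ 4` (the ten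
points `1_{Iᶜ}`, `1_J` span the `4`-dimensional hyperplane `Σ z = 3`, and `4 = 2·2`), `rank_psd A ≥ 3`
(`5 ≤ C(k+1,2)` forces `k ≥ 3`). Whether `rank_psd A = 3` or `4` (Problem 9.1) remains open.
[cite: FawziEtAl2015, §9.1 Problem 9.1 (p24)] -/
theorem FawziEtAl2015_problem91_bounds :
    (fgprtA 5).rank = 5 ∧ HasPsdFactorization (fgprtA 5) 4 ∧
      ∀ k, HasPsdFactorization (fgprtA 5) k → 3 ≤ k := by
  refine ⟨rank_subsetInterMatrix (by norm_num) (by norm_num) (by norm_num) (by norm_num), ?_,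
    fun k hk => ?_⟩
  · exact hasPsdFactorization_subsetInterMatrix_affine (m := 4) (s := 2) (t := 2) (a := 2) (b := 3)
      (by norm_num) (by norm_num)
  · have h5 : 5 ≤ (k + 1).choose 2 :=
      le_choose_of_hasPsdFactorization_subsetInterMatrix (n := 5) (a := 2) (b := 3)
        (by norm_num) (by norm_num) (by norm_num) (by norm_num) hk
    by_contra hk3
    interval_cases k <;> simp [Nat.choose] at h5

end Intersection

end Literature.Combinatorics.Optimization
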